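import Summits.BirchSwinnertonDyer.Rank1Residual.Additive.X4SharpThreeKimConjectureEndState
import Summits.BirchSwinnertonDyer.Rank1Residual.Additive.X4SharpThreeAssembly
import HarnessLib

/-!
# U3 / lens BK (Beilinson–Kato / Kolyvagin-system machine at `p = 3`): the class N11 LOWER half
# `ord₃ #Ш_an ≤ ord₃ #Ш` and its ONE non-printed class-level input — END STATE of the lens, modulo the
# announced structure clause (cell `bsd-uniform`, track U3, seat u3-p2; DRAFT skeleton, dry-run only)

HONEST FRAMING (cell `bsd-uniform`, run/shared/lean/pub/bsd-uniform/, to be repeated in every file of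
the cell): what is proved uniformly here is a BOOKKEEPING EQUIVALENCE, not the lower half itself. On the
class N11 (`ClassX4 W 3`, analytic rank `0`, `ρ̄_{E,3}` onto) the statement "`MissingLowerBoundAt W 3`
for every member" is shown EQUIVALENT — conditionally on ONE announced preprint clause
(`Kim2025.thm11_kimShaLength_of_integralPeriod_OPEN`, Kim–Pollack arXiv:2505.09121v1 Thm. 1.1, PRE,
flag `Kim2025-preprint`), Gross–Zagier–Kolyvagin and modularity — to the conjunction of (i) the `≤`
half of Kim's refined conjecture at `3` (`X4.KimTamagawaDefectLeAt W 3 D.f`: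
`∂^{(∞)}(δ̃_{D.f}) ≤ ord₃ ∏_v c_v`, OPEN — Kim AJM 148 (2026) Conj. 1.10 = Kim 2025 Conj. 7.4) on the
3-adic TOWER rows carrying an admissible datum, (ii) the lower half on tower rows with NO admissible
datum (period transfer / `Ω⁺_f`-integrality: the Manin–period residue R3-4), (iii) the lower half on
the EXOTIC rows (surj(3), no tower; Elkies). So along the Kolyvagin-system machine the lower half at an
additive `3` is, class-wide, EXACTLY the `≤` half of Conj. 1.10 at `3` plus two named residues —
"KMC₃ in disguise" on the `3 ∤ ∏c` rows (Kim Thm. 1.10: unit Kurihara number ⟺ Kato's IMC, printed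
`p ≥ 5`). No class converts from certificate to literal by this file; no density moves; no summit claim.
Reduction types: ALL additive types at `3` with `E[3]` irreducible are in N11 (potentially multiplicative,
potentially good ordinary, potentially supersingular tame or wild); the equivalence does not
distinguish them — the residue is by IMAGE (tower / exotic) and DATUM, named in HOME/RESIDUE.md §U3.
WHY THIS IS NOVEL (one sentence): the tree's end state `n11_rankZero_three_iff_kimTamagawaDefect_of_kim2025_OPEN`
(additive-p4, `Additive/X4SharpThreeKimConjectureEndState.lean`) is the two-sided statement
(`MissingPPartAt` ⟺ Conj. 1.10 EQUALITY); this file isolates the LOWER half (U3's target) against the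
`≤` half alone, so that the BK lens's non-printed step is pinned as ONE inequality-shaped class conjecture.

Theorems only; nothing is re-declared (`MissingLowerBoundAt`, `ClassX4`, `Surj`, `KimTamagawaDefectLeAt`,
the PRE binder are imported by name). The Part B lever of `HOME/u3/ROUTE-BK.md` (companion-form residual
transport on the split locus) and its crux K4 over the interface `KMC` are the sibling file
`Uniform/U3/RouteBKCompanionTransport.lean`; this file is the typed record of Part A (ROUTE-BK §1: "the correct
typed record of this fact (S3)"; referee V10).

References: C.-H. Kim (app. R. Pollack), arXiv:2505.09121v1 (2025) Thm. 1.1, Cor. 1.7, Conj. 7.4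
[Kim2025RefinedTNC] (PRE); C.-H. Kim, Amer. J. Math. 148 (2026) = arXiv:2203.12159v4 Thm. 1.9 (6),
Thm. 1.11, Conj. 1.10 (PDF p. 8) [Kim2022StructureSelmer]; R. Sakamoto, JTNB 36 (2024) Thm. 4.4
[Sakamoto2024]; R. L. Miller, LMS J. Comput. Math. 14 (2011) Def. 1.1 [Miller2011LMS]; J.-P. Serre,
*Abelian ℓ-adic representations* IV-23 Lemma 3 [SerreAbelianLadic1968].
-/

noncomputable section

open scoped Classical

open WeierstrassCurve Literature.NumberTheory.EllipticCurves
  Literature.NumberTheory.EllipticCurves.ModularForms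
  Literature.NumberTheory.EllipticCurves.Rank1Residual
  Literature.NumberTheory.EllipticCurves.Rank1Residual.Typed
  Summit.BirchSwinnertonDyer.Rank1Residual
  Summit.BirchSwinnertonDyer.Rank1Residual.Additive

namespace Summit.BirchSwinnertonDyer.Uniform.U3

/-! ### §1 Per pair on a tower row: the chain and its converse (modulo the preprint) -/

section PerPair

variable (W : WeierstrassCurve ℚ) [W.IsElliptic] [W.IsGloballyMinimal]

/-- **U3-BK, per pair (tower row, admissible datum), CONDITIONAL on the preprint.** On an N11 row
(`ClassX4 W 3`, analytic rank `0`) with the 3-adic tower and a datum `D` with the period transfer and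
`Ω⁺_{D.f}`-integral plus symbols, the `≤` half of Kim's Conj. 1.10 at the pair gives the LOWER half
`MissingLowerBoundAt W 3`. [claim: Kim2025RefinedTNC, status: under-review]
[cite: Kim2025RefinedTNC, Thm. 1.1 ("BSD") (ANNOUNCED, OPEN binder)]
[cite: Kim2022StructureSelmer, Conj. 1.10 (PDF p. 8)] [cite: Miller2011LMS, Def. 1.1] -/
theorem missingLowerBoundAt_three_of_kimTamagawaDefectLe_of_kim2025_OPEN
    (hK25s : Kim2025.thm11_kimShaLength_of_integralPeriod_OPEN)
    (hGZK : rank_eq_analyticRank_of_analyticRank_le_one) (hmod : hasEntireLFunction_rat)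
    (hr : W.analyticRank = 0) (_hX : ClassX4 W 3)
    (htower : ∀ n : ℕ, W.HasSurjectiveModNGaloisRep (3 ^ n : ℕ))
    {N : ℕ} [NeZero N] (D : ModularParametrizationData W N)
    (hper : ∃ u : ℚ, ‖(u : ℚ_[3])‖ = 1 ∧ W.realPeriodRat = u * plusPeriod D.f)
    (hint : ∀ r : ℚ, ratPlusSymbol D.f r ≠ 0 → 0 ≤ padicValRat 3 (ratPlusSymbol D.f r))
    (hle : X4.KimTamagawaDefectLeAt W 3 D.f) : MissingLowerBoundAt W 3 :=
  (missingLowerBoundAt_iff_kimTamagawaDefectLeAt_of_kim2025_OPEN W 3 hK25s hGZK hmod le_rfl hr htower D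
    hper hint).mpr hle

/-- **Converse (necessity of the input), CONDITIONAL on the preprint.** On the same row the LOWER
half forces the `≤` half of Conj. 1.10 at the pair: the input is not merely sufficient.
[claim: Kim2025RefinedTNC, status: under-review]
[cite: Kim2025RefinedTNC, Thm. 1.1 ("BSD") (ANNOUNCED, OPEN binder)] [cite: Kim2022StructureSelmer, Conj. 1.10 (PDF p. 8)] -/
theorem kimTamagawaDefectLeAt_three_of_missingLowerBoundAt_of_kim2025_OPEN
    (hK25s : Kim2025.thm11_kimShaLength_of_integralPeriod_OPEN)
    (hGZK : rank_eq_analyticRank_of_analyticRank_le_one) (hmod : hasEntireLFunction_rat)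
    (hr : W.analyticRank = 0) (_hX : ClassX4 W 3)
    (htower : ∀ n : ℕ, W.HasSurjectiveModNGaloisRep (3 ^ n : ℕ))
    {N : ℕ} [NeZero N] (D : ModularParametrizationData W N)
    (hper : ∃ u : ℚ, ‖(u : ℚ_[3])‖ = 1 ∧ W.realPeriodRat = u * plusPeriod D.f)
    (hint : ∀ r : ℚ, ratPlusSymbol D.f r ≠ 0 → 0 ≤ padicValRat 3 (ratPlusSymbol D.f r))
    (hlow : MissingLowerBoundAt W 3) : X4.KimTamagawaDefectLeAt W 3 D.f :=
  (missingLowerBoundAt_iff_kimTamagawaDefectLeAt_of_kim2025_OPEN W 3 hK25s hGZK hmod le_rfl hr htower D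
    hper hint).mp hlow

/-- **The tower from class certificates.** On an N11 row with surj(3), a `j`-witness (a prime `q ≠ 3`
with `ord_q j < 0`, `3 ∤ ord_q j`) OR surj(9) gives the 3-adic tower, so the chain reads off class
data plus the datum and the `≤` half. [claim: Kim2025RefinedTNC, status: under-review]
[cite: SerreAbelianLadic1968, Ch. IV §3.4, Lemma 3 (IV-23)] [cite: Kim2022StructureSelmer, Conj. 1.10 (PDF p. 8)] -/
theorem missingLowerBoundAt_three_of_kimTamagawaDefectLe_of_surj_of_jWitness_or_nine
    (hK25s : Kim2025.thm11_kimShaLength_of_integralPeriod_OPEN)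
    (hGZK : rank_eq_analyticRank_of_analyticRank_le_one) (hmod : hasEntireLFunction_rat)
    (hr : W.analyticRank = 0) (hX : ClassX4 W 3) (hsurj : Surj W 3)
    (hcert : (∃ q : ℕ, q.Prime ∧ q ≠ 3 ∧ padicValRat q W.j < 0 ∧ ¬ (3 : ℤ) ∣ padicValRat q W.j) ∨
      W.HasSurjectiveModNGaloisRep 9)
    {N : ℕ} [NeZero N] (D : ModularParametrizationData W N)
    (hper : ∃ u : ℚ, ‖(u : ℚ_[3])‖ = 1 ∧ W.realPeriodRat = u * plusPeriod D.f)
    (hint : ∀ r : ℚ, ratPlusSymbol D.f r ≠ 0 → 0 ≤ padicValRat 3 (ratPlusSymbol D.f r))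
    (hle : X4.KimTamagawaDefectLeAt W 3 D.f) : MissingLowerBoundAt W 3 :=
  missingLowerBoundAt_three_of_kimTamagawaDefectLe_of_kim2025_OPEN W hK25s hGZK hmod hr hX
    (towerSurj_three_of_surj_of_jWitness_or_nine W hsurj hcert) D hper hint hle

end PerPair

/-! ### §2 The class statement: N11 LOWER half ⟺ (`≤` half of Conj. 1.10 on admissible tower rows) ∧ residues -/

/-- **N11 LOWER-half END STATE along the BK lens, CONDITIONAL on the announced structure clause**
(`hK25s`), GZK and modularity: "`MissingLowerBoundAt W 3` on every X4 ∧ `r_an = 0` ∧ surj(3) pair" is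
EQUIVALENT to the conjunction of (i) the `≤` half of Kim's Conj. 1.10 at `3` (`X4.KimTamagawaDefectLeAt
W 3 D.f`) on every 3-adic TOWER row for every admissible₃ datum, (ii) the lower half on the tower rows
admitting NO admissible₃ datum, (iii) the lower half on the EXOTIC rows (surj(3), no tower). The BK lens's
non-printed class-level step is (i) — an inequality-shaped printed conjecture at `3` — and nothing weaker.
[claim: Kim2025RefinedTNC, status: under-review]
[cite: Kim2025RefinedTNC, Thm. 1.1 ("BSD"), Conj. 7.4 (ANNOUNCED, OPEN binder)]
[cite: Kim2022StructureSelmer, Conj. 1.10 (PDF p. 8)] [cite: Miller2011LMS, Def. 1.1] -/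
theorem n11Lower_rankZero_three_iff_kimTamagawaDefectLe_of_kim2025_OPEN
    (hK25s : Kim2025.thm11_kimShaLength_of_integralPeriod_OPEN)
    (hGZK : rank_eq_analyticRank_of_analyticRank_le_one) (hmod : hasEntireLFunction_rat) :
    (∀ (W : WeierstrassCurve ℚ) [W.IsElliptic] [W.IsGloballyMinimal],
        W.analyticRank = 0 → ClassX4 W 3 → Surj W 3 → MissingLowerBoundAt W 3) ↔
      (∀ (W : WeierstrassCurve ℚ) [W.IsElliptic] [W.IsGloballyMinimal],
          W.analyticRank = 0 → ClassX4 W 3 → (∀ n : ℕ, W.HasSurjectiveModNGaloisRep (3 ^ n : ℕ)) →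
          ∀ {N : ℕ} [NeZero N] (D : ModularParametrizationData W N),
          (∃ u : ℚ, ‖(u : ℚ_[3])‖ = 1 ∧ W.realPeriodRat = u * plusPeriod D.f) →
          (∀ r : ℚ, ratPlusSymbol D.f r ≠ 0 → 0 ≤ padicValRat 3 (ratPlusSymbol D.f r)) →
          X4.KimTamagawaDefectLeAt W 3 D.f) ∧
      (∀ (W : WeierstrassCurve ℚ) [W.IsElliptic] [W.IsGloballyMinimal],
          W.analyticRank = 0 → ClassX4 W 3 → (∀ n : ℕ, W.HasSurjectiveModNGaloisRep (3 ^ n : ℕ)) →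
          (∀ (N : ℕ) [NeZero N] (D : ModularParametrizationData W N),
            (¬ ∃ u : ℚ, ‖(u : ℚ_[3])‖ = 1 ∧ W.realPeriodRat = u * plusPeriod D.f) ∨
            ¬ ∀ r : ℚ, ratPlusSymbol D.f r ≠ 0 → 0 ≤ padicValRat 3 (ratPlusSymbol D.f r)) →
          MissingLowerBoundAt W 3) ∧
      (∀ (W : WeierstrassCurve ℚ) [W.IsElliptic] [W.IsGloballyMinimal],
          W.analyticRank = 0 → ClassX4 W 3 → Surj W 3 →
          ¬ (∀ n : ℕ, W.HasSurjectiveModNGaloisRep (3 ^ n : ℕ)) → MissingLowerBoundAt W 3) := by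
  have h3 : (3 : ℕ) ≤ 3 := le_rfl
  constructor
  · intro hN11
    refine ⟨fun W _ _ hr hX ht N _ D hper hint ↦ ?_, fun W _ _ hr hX ht _ ↦ ?_,
      fun W _ _ hr hX hs _ ↦ hN11 W hr hX hs⟩
    · have hs : W.HasSurjectiveModNGaloisRep 3 := by simpa using ht 1
      exact (missingLowerBoundAt_iff_kimTamagawaDefectLeAt_of_kim2025_OPEN W 3 hK25s hGZK hmod h3 hr ht
        D hper hint).mp (hN11 W hr hX hs)
    · have hs : W.HasSurjectiveModNGaloisRep 3 := by simpa using ht 1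
      exact hN11 W hr hX hs
  · rintro ⟨hconj, hres, hexo⟩ W _ _ hr hX hs
    by_cases ht : ∀ n : ℕ, W.HasSurjectiveModNGaloisRep (3 ^ n : ℕ)
    · by_cases hD : ∃ (N : ℕ) (_ : NeZero N) (D : ModularParametrizationData W N),
          (∃ u : ℚ, ‖(u : ℚ_[3])‖ = 1 ∧ W.realPeriodRat = u * plusPeriod D.f) ∧
            ∀ r : ℚ, ratPlusSymbol D.f r ≠ 0 → 0 ≤ padicValRat 3 (ratPlusSymbol D.f r)
      · obtain ⟨N, hNz, D, hper, hint⟩ := hD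
        exact (missingLowerBoundAt_iff_kimTamagawaDefectLeAt_of_kim2025_OPEN W 3 hK25s hGZK hmod h3 hr
          ht D hper hint).mpr (hconj W hr hX ht D hper hint)
      · refine hres W hr hX ht fun N _ D ↦ ?_
        by_contra hnot
        simp only [not_or, not_not] at hnot
        exact hD ⟨N, inferInstance, D, hnot.1, hnot.2⟩
    · exact hexo W hr hX hs ht


end Summit.BirchSwinnertonDyer.Uniform.U3

end
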